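import Summits.AtomisticToContinuum.BoseEinsteinCondensation.Theses.BECParticleIncrement

/-!
# Route `BECParticleIncrement`, support item `StepInduction` (stmt-AtomisticToContinuum-12324)

Settles the support item `stmt-AtomisticToContinuum-12324` of route
`route-AtomisticToContinuum-BECParticleIncrement`: the glue of the regime split

  `GPWindowIncrement → (∀ v, IsRepulsiveFiniteRange v → scatteringLength v ≠ ⊤) →
    StaticResponseBound → BootstrapStep → IncrementBound`.

Proof (pure logic plus real / `ℝ≥0∞` arithmetic, as planned by the route): given a repulsive
finite-range `v`, take the constant `C` (with its density `ρS` and box size `LS`) from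
`StaticResponseBound`, the bulk-regime data `(g₀, ρB, LB)` from `BootstrapStep` at that `C`, and
the box size `LG` from `GPWindowIncrement` at the ratio `max g₀ 1 > 0` (the finiteness of the
scattering length being the second hypothesis). Set `ρ₁ := min ρS ρB` and
`L₀ := max (max LS LB) (max LG 1)`. For `L ≥ L₀` argue by strong induction on the particle number
`M` with `M + 1 ≤ ρ₁ L³`: if `(M + 1) a ≤ max g₀ 1 · L` the increment is the Gross–Pitaevskii
window; otherwise `g₀ L ≤ max g₀ 1 · L < (M + 1) a` (as `L ≥ 1 ≥ 0`) and `BootstrapStep` applies,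
its three hypotheses being (i) the increments below `M` (induction hypothesis, the density
condition being monotone in `M`), (ii) their telescoped form `M'/2 ≤ λ_max(γ_{M'})` for
`M' ≤ M` (from `condensateNumber v 0 L ≥ 0` and `ofReal ((m+1)/2) = ofReal (m/2) + 2⁻¹`), and
(iii) the static-response inequality at every `M' ≤ M + 1 ≤ ρ₁ L³ ≤ ρS L³`.

References: [LSSY2005, Ch. 5] (the setting: Dirichlet-box ground states of the dilute Bose gas and
the condensate number `λ_max`); the statement itself is route-internal glue [folklore].
-/

namespace Summit.AtomisticToContinuum.BoseEinsteinCondensation.Theorems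

open Literature.MathematicalPhysics.QuantumManyBody.BoseGas
open Summit.AtomisticToContinuum.BoseEinsteinCondensation.Theses.BECParticleIncrement

/-- Arithmetic of one half in `ℝ≥0∞`: `ofReal ((m + 1) / 2) = ofReal (m / 2) + 2⁻¹` for `m : ℕ`.
[folklore] -/
theorem becParticleIncrement_ofReal_succ_half (m : ℕ) :
    ENNReal.ofReal (((m + 1 : ℕ) : ℝ) / 2) = ENNReal.ofReal ((m : ℝ) / 2) + 2⁻¹ := by
  have h2 : (2⁻¹ : ENNReal) = ENNReal.ofReal ((1 : ℝ) / 2) := by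
    rw [one_div, ENNReal.ofReal_inv_of_pos (by norm_num : (0 : ℝ) < 2), ENNReal.ofReal_ofNat]
  rw [h2, ← ENNReal.ofReal_add (by positivity) (by positivity)]
  congr 1
  push_cast
  ring

/-- **Item stmt-AtomisticToContinuum-12324** (`StepInduction` of route `BECParticleIncrement`,
exact route decl): the regime split glued by strong induction on the particle number in a fixed
Dirichlet box — `GPWindowIncrement` (base regime `(M+1)a ≤ max g₀ 1 · L`), finiteness of the
scattering length, `StaticResponseBound` (supplying the constant `C`) and `BootstrapStep` (bulk
regime, fed by the induction hypothesis, its telescoped form and the response inequality) together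
give `IncrementBound` with `ρ₁ := min ρS ρB`, `L₀ := max (max LS LB) (max LG 1)`. [folklore] -/
theorem becParticleIncrement_stepInduction_proof :
    Summit.AtomisticToContinuum.BoseEinsteinCondensation.Theses.BECParticleIncrement.StepInduction := by
  unfold Theses.BECParticleIncrement.StepInduction Theses.BECParticleIncrement.IncrementBound
  intro hG hA hS hB v hv
  -- the constant (and dilute range) of the static-response bound
  obtain ⟨C, ρS, LS, hρS, hSv⟩ := hS v hv
  -- the bulk-regime step at that constant
  obtain ⟨g₀, ρB, LB, hρB, hBv⟩ := hB v hv C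
  -- the Gross–Pitaevskii window at the ratio `max g₀ 1 > 0`
  obtain ⟨LG, hGv⟩ := hG v hv (hA v hv) (max g₀ 1) (lt_of_lt_of_le one_pos (le_max_right g₀ 1))
  refine ⟨min ρS ρB, max (max LS LB) (max LG 1), lt_min hρS hρB, ?_⟩
  intro L hL
  have hLS : LS ≤ L := le_trans (le_trans (le_max_left LS LB) (le_max_left _ _)) hL
  have hLB : LB ≤ L := le_trans (le_trans (le_max_right LS LB) (le_max_left _ _)) hL
  have hLG : LG ≤ L := le_trans (le_trans (le_max_left LG 1) (le_max_right _ _)) hL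
  have hL1 : (1 : ℝ) ≤ L := le_trans (le_trans (le_max_right LG 1) (le_max_right _ _)) hL
  have hL0 : (0 : ℝ) ≤ L := le_trans zero_le_one hL1
  have hL3 : (0 : ℝ) ≤ L ^ 3 := pow_nonneg hL0 3
  have hρSL : min ρS ρB * L ^ 3 ≤ ρS * L ^ 3 := mul_le_mul_of_nonneg_right (min_le_left _ _) hL3
  have hρBL : min ρS ρB * L ^ 3 ≤ ρB * L ^ 3 := mul_le_mul_of_nonneg_right (min_le_right _ _) hL3
  intro M
  -- strong induction on the particle number inside the fixed box
  induction M using Nat.strong_induction_on with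
  | _ M ih =>
    intro hM
    by_cases hgp : ((M : ℝ) + 1) * (scatteringLength v).toReal ≤ max g₀ 1 * L
    · -- Gross–Pitaevskii window: the base regime
      exact hGv L hLG M hgp
    · -- bulk regime: `BootstrapStep`
      push Not at hgp
      have hg : g₀ * L < ((M : ℝ) + 1) * (scatteringLength v).toReal :=
        lt_of_le_of_lt (mul_le_mul_of_nonneg_right (le_max_left g₀ 1) hL0) hgp
      have hMB : (M : ℝ) + 1 ≤ ρB * L ^ 3 := le_trans hM hρBL
      -- (i) increments below `M`: the induction hypothesis
      have hinc : ∀ M' : ℕ, M' < M →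
          condensateNumber v M' L + 2⁻¹ ≤ condensateNumber v (M' + 1) L := by
        intro M' hM'
        refine ih M' hM' ?_
        have h1 : (M' : ℝ) + 1 ≤ (M : ℝ) := by exact_mod_cast hM'
        linarith
      -- (ii) telescoped: `M'/2 ≤ λ_max(γ_{M'})` for all `M' ≤ M`
      have htel : ∀ M' : ℕ, M' ≤ M →
          ENNReal.ofReal ((M' : ℝ) / 2) ≤ condensateNumber v M' L := by
        intro M'
        induction M' with
        | zero => intro _; simp
        | succ m ihm =>
          intro hm
          calc ENNReal.ofReal (((m + 1 : ℕ) : ℝ) / 2)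
              = ENNReal.ofReal ((m : ℝ) / 2) + 2⁻¹ := becParticleIncrement_ofReal_succ_half m
            _ ≤ condensateNumber v m L + 2⁻¹ := add_le_add (ihm (Nat.le_of_succ_le hm)) le_rfl
            _ ≤ condensateNumber v (m + 1) L := hinc m (Nat.lt_of_succ_le hm)
      -- (iii) the static-response inequality at every `M' ≤ M + 1 ≤ ρ₁ L³ ≤ ρS L³`
      have hresp := fun (M' : ℕ) (hM' : M' ≤ M + 1) =>
        hSv L hLS M' (by
          have h1 : (M' : ℝ) ≤ (M : ℝ) + 1 := by exact_mod_cast hM'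
          linarith)
      exact hBv L hLB M hg hMB htel hinc hresp

end Summit.AtomisticToContinuum.BoseEinsteinCondensation.Theorems
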